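import Summits.Parity.BatemanHorn.Theorems.SelbergDelangeRigidityLSDRealSegmentTailsTwoAPriori
import HarnessLib

/-!
# Route `SelbergDelangeRigidity`, crux `LSDRealSegment` (stmt-Parity-9770), line
# `product-anatomy-subcritical`: clause (a) of `stub_tailsTwo` (the a priori bound) in total degree `2` FROM THE ENGINE

`tailsTwo_aPrioriBound_of_engine` (registered helper): clause (a) of `stub_tailsTwo`, `APrioriBound k f y`, for a Bateman–Horn system `f` of total
degree `2` and `1 ≤ y < 2` — the landed `tailsTwo_aPrioriBound_of_facts` (`…TailsTwoAPriori.lean`: same proof, its helpers reused) made UNCONDITIONAL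
by taking as hypotheses (E) the conclusion of the small-prime restoration engine for `(f, y)` (the body of `tailsTwo_engine` at `B = 1`, every `A ≥ 1`
and cut `P`).  Purpose: the engine's named inputs changed (`NairTenenbaum1998_theorem1` is MISSTATED — Henriot's `α < 1` vs the printed `α < 1/2`,
Erratum 2 of `NairTenenbaumShortSums.lean`; the engine needs `α = 1/4` — and `BugeaudEvertseGyory2018_SPartPolynomialValues` is now proved); the
clause is re-assembled on `NairTenenbaum1998_theorem1_printed` in `…TailsTwoPrinted.lean`.
-/

open Filter Finset Polynomial
open scoped BigOperators Topology Classical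

namespace Summit.Parity.BatemanHorn.Cruxes.LSDRealSegment.ProductAnatomySubcritical

open Literature.NumberTheory.Sieve
open ArithmeticFunction (cardFactors)
noncomputable section

/-- **tailsTwo_aPrioriBound_of_engine** (registered helper of `stub_tailsTwo`, line `product-anatomy-subcritical`): clause (a) of `stub_tailsTwo`,
`APrioriBound k f y`, in total degree `2`, `1 ≤ y < 2`, GIVEN (E) the engine bound for `(f, y)` (body of `tailsTwo_engine`, `B = 1`); proof of
`tailsTwo_aPrioriBound_of_facts` verbatim. [folklore] -/
theorem tailsTwo_aPrioriBound_of_engine : ∀ (k : ℕ) (f : Fin k → ℤ[X]), IsBatemanHornSystem f → (∑ i, (f i).natDegree) = 2 →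
    ∀ y : ℝ, 1 ≤ y → y < 2 →
    (∀ (A : ℝ) (P : ℕ), 1 ≤ A → ∃ C : ℝ, ∃ X₀ : ℕ, 0 ≤ C ∧ ∀ (F : Fin k → ℕ → ℝ),
      (∀ i, IsClassM A 1 ((1 - Real.logb 2 y) / (9216 * (k + 1))) (F i)) → (∀ i m, F i m = F i (roughPart (P : ℝ) m)) →
      (∀ i, F i 1 ≤ 1) → ∀ (𝒮 : (Fin k → ℕ) → Prop) (X : ℕ), X₀ ≤ X →
        (∑ n ∈ (Finset.Ioc X (2 * X)).filter (fun n => 𝒮 (fun i => smoothPart (P : ℝ) (val f i n))),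
            ∏ i, (y ^ cardFactors (smoothPart (P : ℝ) (val f i n)) * F i (val f i n))) ≤
          C * ((X : ℝ) / Real.log X ^ k) * (∏ i, ∑ m ∈ Finset.Icc 1 (2 * X), F i m * (polyRootCountMod ![f i] m : ℝ) / m) *
              (∑ s ∈ (Fintype.piFinset fun _ : Fin k => Finset.Icc 1 X).filter (fun s => (∀ i, ∀ p ∈ (s i).primeFactors, p ≤ P) ∧ 𝒮 s),
                y ^ cardFactors (∏ i, s i) * (#((Finset.range (Finset.univ.lcm s * primorial P)).filter (fun r : ℕ =>
                  ∀ i, ((s i : ℕ) : ℤ) ∣ (f i).eval (r : ℤ) ∧ ∀ p ∈ Nat.primesLE P, ¬ ((p ^ ((s i).factorization p + 1) : ℕ) : ℤ) ∣ (f i).eval (r : ℤ))) : ℝ) /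
                  ((Finset.univ.lcm s * primorial P : ℕ) : ℝ)) + (X : ℝ) ^ (1 - (1 - Real.logb 2 y) / 6)) →
    APrioriBound k f y := by
  intro k f hf hdeg y hy hy2 hE
  have hy0 : 0 ≤ y := by linarith
  set lam : ℝ := Real.logb 2 y with hlam
  have hlam1 : lam < 1 := by
    rw [hlam, Real.logb_lt_iff_lt_rpow one_lt_two (by linarith), Real.rpow_one]; exact hy2
  set θ : ℝ := (1 - lam) / 6 with hθdef
  have hθ : 0 < θ := by rw [hθdef]; linarith
  set ε₁ : ℝ := (1 - Real.logb 2 y) / (9216 * (k + 1)) with hε₁def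
  have hε₁ : 0 < ε₁ := by rw [hε₁def]; exact div_pos (by rw [← hlam]; linarith) (by positivity)
  -- the cut `P` with `P^{ε₁} ≥ y`
  set P : ℕ := ⌊y ^ (1 / ε₁)⌋₊ + 1 with hPdef
  have hP1 : 1 ≤ P := by omega
  have hyP : y ≤ (P : ℝ) ^ ε₁ := by
    have h1 : y ^ (1 / ε₁) ≤ (P : ℝ) := by
      rw [hPdef]; push_cast; exact (Nat.lt_floor_add_one _).le
    calc y = (y ^ (1 / ε₁)) ^ ε₁ := by rw [← Real.rpow_mul hy0, one_div_mul_cancel hε₁.ne', Real.rpow_one]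
      _ ≤ (P : ℝ) ^ ε₁ := Real.rpow_le_rpow (by positivity) h1 hε₁.le
  obtain ⟨hcls, hFr, hF1, hFle⟩ := peeledWeight_props hy hε₁ hP1 hyP
  -- the engine, the harmonic factors, the class densities, the smooth series
  obtain ⟨C, X₀, hC0, hengine⟩ := hE y P hy
  obtain ⟨Ch', hCh'⟩ := tails_rootCountHarmonic_le k f hf y hy hy2
  obtain ⟨Kz, hKz0, hKz⟩ := tailsTwo_classDensity_le k f hf hdeg P
  obtain ⟨⟨Ks, hKs⟩, -⟩ := tailsTwo_smoothSeries y P hy hy2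
  set Ch : ℝ := max Ch' 0 with hChdef
  have hCh0 : 0 ≤ Ch := le_max_right _ _
  have hCh : ∀ (j : Fin k) (N : ℕ), 2 ≤ N →
      (∑ m ∈ Finset.Icc 1 N, y ^ cardFactors m * (polyRootCountMod ![f j] m : ℝ) / m) ≤ Ch * Real.log N ^ y :=
    fun j N hN => (hCh' j N hN).trans (mul_le_mul_of_nonneg_right (le_max_left _ _)
      (Real.rpow_nonneg (Real.log_natCast_nonneg N) y))
  have hKs0 : 0 ≤ Ks := le_trans (Finset.sum_nonneg fun m _ => by positivity) (hKs 1)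
  -- the block bound
  set e : ℝ := (k : ℝ) * (y - 1) with he
  have he0 : 0 ≤ e := by positivity
  set Cblk : ℝ := C * (Ch * 2 ^ y) ^ k * (Kz * Ks ^ k) + 1 / Real.log 2 ^ e with hCblk
  have hblk : ∀ X : ℕ, max X₀ 2 ≤ X → ∑ n ∈ Finset.Ioc X (2 * X), y ^ stat f n ≤ Cblk * ((X : ℝ) * Real.log X ^ e) := by
    intro X hX
    have hXX₀ : X₀ ≤ X := le_of_max_le_left hX
    have hX2 : 2 ≤ X := le_of_max_le_right hX
    have hXr : (2 : ℝ) ≤ X := by exact_mod_cast hX2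
    have hXpos : (0 : ℝ) < X := by linarith
    have hlogX : 0 < Real.log X := Real.log_pos (by linarith)
    have hlog2 : Real.log 2 ≤ Real.log X := Real.log_le_log two_pos hXr
    have h := hengine (fun _ m => y ^ cardFactors (roughPart (P : ℝ) m)) (fun _ => hcls) (fun _ m => hFr m)
      (fun _ => hF1) (fun _ => True) X hXX₀
    simp only [Finset.filter_true] at h
    rw [Finset.sum_congr rfl fun n _ => pow_stat_eq_prod_smooth_rough f y P n]
    refine h.trans ?_
    -- the harmonic factors
    have hH : ∏ i, ∑ m ∈ Finset.Icc 1 (2 * X), y ^ cardFactors (roughPart (P : ℝ) m) * (polyRootCountMod ![f i] m : ℝ) / m ≤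
        (Ch * 2 ^ y) ^ k * Real.log X ^ (y * k) := by
      have hone : ∀ i, ∑ m ∈ Finset.Icc 1 (2 * X), y ^ cardFactors (roughPart (P : ℝ) m) * (polyRootCountMod ![f i] m : ℝ) / m ≤
          Ch * 2 ^ y * Real.log X ^ y := by
        intro i
        calc _ ≤ ∑ m ∈ Finset.Icc 1 (2 * X), y ^ cardFactors m * (polyRootCountMod ![f i] m : ℝ) / m :=
              Finset.sum_le_sum fun m _ => div_le_div_of_nonneg_right
                (mul_le_mul_of_nonneg_right (hFle m) (Nat.cast_nonneg _)) (Nat.cast_nonneg _)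
          _ ≤ Ch * Real.log ((2 * X : ℕ) : ℝ) ^ y := hCh i (2 * X) (by omega)
          _ ≤ Ch * (2 * Real.log X) ^ y := by
              refine mul_le_mul_of_nonneg_left (Real.rpow_le_rpow (Real.log_natCast_nonneg _) ?_ hy0) hCh0
              push_cast
              rw [Real.log_mul two_ne_zero hXpos.ne']
              linarith
          _ = Ch * 2 ^ y * Real.log X ^ y := by rw [Real.mul_rpow zero_le_two hlogX.le]; ring
      calc _ ≤ ∏ _i : Fin k, Ch * 2 ^ y * Real.log X ^ y :=
            Finset.prod_le_prod (fun i _ => Finset.sum_nonneg fun m _ => by positivity) fun i _ => hone i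
        _ = (Ch * 2 ^ y) ^ k * (Real.log X ^ y) ^ k := by
            rw [Finset.prod_const, Finset.card_univ, Fintype.card_fin, mul_pow]
        _ = (Ch * 2 ^ y) ^ k * Real.log X ^ (y * k) := by rw [← Real.rpow_natCast (Real.log X ^ y), ← Real.rpow_mul hlogX.le]
    -- the densities
    have hZ : ∑ s ∈ (Fintype.piFinset fun _ : Fin k => Finset.Icc 1 X).filter
          (fun s => (∀ i, ∀ p ∈ (s i).primeFactors, p ≤ P) ∧ True),
        y ^ cardFactors (∏ i, s i) *
          (#((Finset.range (Finset.univ.lcm s * primorial P)).filter (fun r : ℕ =>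
              ∀ i, ((s i : ℕ) : ℤ) ∣ (f i).eval (r : ℤ) ∧ ∀ p ∈ Nat.primesLE P,
                ¬ ((p ^ ((s i).factorization p + 1) : ℕ) : ℤ) ∣ (f i).eval (r : ℤ))) : ℝ) /
          ((Finset.univ.lcm s * primorial P : ℕ) : ℝ) ≤ Kz * Ks ^ k := by
      set box := (Fintype.piFinset fun _ : Fin k => Finset.Icc 1 X).filter
        (fun s => (∀ i, ∀ p ∈ (s i).primeFactors, p ≤ P) ∧ True) with hbox
      have hpt : ∀ s ∈ box, y ^ cardFactors (∏ i, s i) *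
          (#((Finset.range (Finset.univ.lcm s * primorial P)).filter (fun r : ℕ =>
              ∀ i, ((s i : ℕ) : ℤ) ∣ (f i).eval (r : ℤ) ∧ ∀ p ∈ Nat.primesLE P,
                ¬ ((p ^ ((s i).factorization p + 1) : ℕ) : ℤ) ∣ (f i).eval (r : ℤ))) : ℝ) /
          ((Finset.univ.lcm s * primorial P : ℕ) : ℝ) ≤ Kz * ∏ i, (y ^ cardFactors (s i) / (s i)) := by
        intro s hs
        rw [hbox, Finset.mem_filter, Fintype.mem_piFinset] at hs
        have hs1 : ∀ i, s i ≠ 0 := fun i => by have := (Finset.mem_Icc.mp (hs.1 i)).1; omega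
        have hd := hKz s hs1 hs.2.1
        rw [mul_div_assoc, cardFactors_finset_prod _ _ fun i _ => hs1 i, ← Finset.prod_pow_eq_pow_sum]
        calc (∏ i, y ^ cardFactors (s i)) * _ ≤ (∏ i, y ^ cardFactors (s i)) * (Kz / ((∏ i, s i : ℕ) : ℝ)) :=
              mul_le_mul_of_nonneg_left hd (Finset.prod_nonneg fun i _ => pow_nonneg hy0 _)
          _ = Kz * ∏ i, (y ^ cardFactors (s i) / (s i)) := by
              rw [Finset.prod_div_distrib, Nat.cast_prod]; ring
      refine (Finset.sum_le_sum hpt).trans ?_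
      rw [← Finset.mul_sum]
      refine mul_le_mul_of_nonneg_left ?_ hKz0
      have hsub : box ⊆ Fintype.piFinset fun _ : Fin k => (Finset.Icc 1 X).filter fun m : ℕ => ∀ p ∈ m.primeFactors, p ≤ P := by
        intro s hs
        rw [hbox, Finset.mem_filter, Fintype.mem_piFinset] at hs
        exact Fintype.mem_piFinset.mpr fun i => Finset.mem_filter.mpr ⟨hs.1 i, hs.2.1 i⟩
      calc ∑ s ∈ box, ∏ i, (y ^ cardFactors (s i) / (s i))
          ≤ ∑ s ∈ Fintype.piFinset (fun _ : Fin k => (Finset.Icc 1 X).filter fun m : ℕ => ∀ p ∈ m.primeFactors, p ≤ P),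
              ∏ i, (y ^ cardFactors (s i) / (s i)) :=
            Finset.sum_le_sum_of_subset_of_nonneg hsub fun s _ _ => Finset.prod_nonneg fun i _ => by positivity
        _ = ∏ _i : Fin k, ∑ m ∈ (Finset.Icc 1 X).filter (fun m : ℕ => ∀ p ∈ m.primeFactors, p ≤ P), y ^ cardFactors m / m :=
            (Finset.prod_univ_sum (fun _ : Fin k => (Finset.Icc 1 X).filter fun m : ℕ => ∀ p ∈ m.primeFactors, p ≤ P)
              (fun _ m => y ^ cardFactors m / m)).symm
        _ ≤ ∏ _i : Fin k, Ks := Finset.prod_le_prod (fun i _ => Finset.sum_nonneg fun m _ => by positivity) fun i _ => hKs X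
        _ = Ks ^ k := by rw [Finset.prod_const, Finset.card_univ, Fintype.card_fin]
    -- assemble the block
    have hpow : Real.log X ^ (y * k) / Real.log X ^ k = Real.log X ^ e := by
      rw [← Real.rpow_natCast (Real.log X) k, ← Real.rpow_sub hlogX, he]; ring_nf
    have hsparse : (X : ℝ) ^ (1 - (1 - Real.logb 2 y) / 6) ≤ 1 / Real.log 2 ^ e * ((X : ℝ) * Real.log X ^ e) := by
      have h1 : (X : ℝ) ^ (1 - (1 - Real.logb 2 y) / 6) ≤ X := by
        calc (X : ℝ) ^ (1 - (1 - Real.logb 2 y) / 6) ≤ (X : ℝ) ^ (1 : ℝ) :=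
              Real.rpow_le_rpow_of_exponent_le (by linarith) (by rw [← hlam]; linarith)
          _ = X := Real.rpow_one _
      have h2 : Real.log 2 ^ e ≤ Real.log X ^ e := Real.rpow_le_rpow (Real.log_nonneg one_le_two) hlog2 he0
      have hl2 : 0 < Real.log 2 ^ e := Real.rpow_pos_of_pos (Real.log_pos one_lt_two) e
      rw [div_mul_eq_mul_div, le_div_iff₀ hl2, one_mul]
      calc (X : ℝ) ^ (1 - (1 - Real.logb 2 y) / 6) * Real.log 2 ^ e ≤ X * Real.log X ^ e :=
            mul_le_mul h1 h2 hl2.le (by linarith)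
        _ = _ := by ring
    calc C * ((X : ℝ) / Real.log X ^ k) * (∏ i, ∑ m ∈ Finset.Icc 1 (2 * X),
          y ^ cardFactors (roughPart (P : ℝ) m) * (polyRootCountMod ![f i] m : ℝ) / m) * _ + (X : ℝ) ^ (1 - (1 - Real.logb 2 y) / 6)
        ≤ C * ((X : ℝ) / Real.log X ^ k) * ((Ch * 2 ^ y) ^ k * Real.log X ^ (y * k)) * (Kz * Ks ^ k) +
            1 / Real.log 2 ^ e * ((X : ℝ) * Real.log X ^ e) := by
          refine add_le_add (mul_le_mul (mul_le_mul_of_nonneg_left hH (by positivity)) ?_ ?_ (by positivity)) hsparse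
          · convert hZ
            rfl
          · exact Finset.sum_nonneg fun s _ => div_nonneg (mul_nonneg (pow_nonneg hy0 _) (Nat.cast_nonneg _)) (Nat.cast_nonneg _)
      _ = C * (Ch * 2 ^ y) ^ k * (Kz * Ks ^ k) * ((X : ℝ) * (Real.log X ^ (y * k) / Real.log X ^ k)) +
            1 / Real.log 2 ^ e * ((X : ℝ) * Real.log X ^ e) := by ring
      _ = Cblk * ((X : ℝ) * Real.log X ^ e) := by rw [hpow, hCblk]; ring
  obtain ⟨C', hC'⟩ := sum_range_le_of_blocks (w := fun n => y ^ stat f n) (fun n => pow_nonneg hy0 _) he0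
    (by positivity : 0 ≤ Cblk) hblk
  exact ⟨C', fun x hx => hC' x hx⟩

end

end Summit.Parity.BatemanHorn.Cruxes.LSDRealSegment.ProductAnatomySubcritical
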